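import Summits.SmoothPoincare4.SmoothPoincare4.Theorems.ConvexBisectionAcyclicBisectionExistsStdSympChain
import HarnessLib

/-!
# A vector of `ℤ^{2g}` is determined by its pairings with the chain vectors; the class with pairings
# `−[i = 3]` is `e_1` (wave 6, brick G6-12 — algebra for the last geometric input (R-E1CURVE) of node
# N3a `node_STcurve` of stub `stub_STgeo` = NF4 N3, line `modp-braid-orbits`, crux
# `ConvexBisection.AcyclicBisectionExists`, item stmt-SmoothPoincare4-10508; registered sub-goal
# `helper_eq_single_one_of_stdSymp_chainVec`)

The shadow of the one remaining curve of N3a (a charted page curve of class `±e_1`, report G6 §3) is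
best computed through CROSSING NUMBERS with Y4's model chain `(b i, ψ i)`:
`crossingNumber (ψ i) K = stdSymp ℤ g (chainVec g i) (shadow g K)` (`helper_crossingNumber_eq_stdSymp`).  This
file supplies the algebra turning the `2g` crossing numbers into the class:

* `eq_of_stdSymp_chainVec_eq` — two vectors with the same pairings against all chain vectors
  `chainVec g i`, `i < 2g`, are equal (the chain vectors are a basis, `chainVec_basis`, and
  `stdSymp (e_j) x = x_{f_j}`, `stdSymp (f_j) x = −x_{e_j}`);
* `stdSymp_chainVec_single_inl_one` — `stdSymp (chainVec g i) e_1 = −[i = 3]`;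
* **`eq_single_one_of_stdSymp_chainVec`** (registered `helper_eq_single_one_of_stdSymp_chainVec`) — if
  `stdSymp (chainVec g i) x = if i = 3 then σ else 0` for all `i < 2g` (`g ≥ 2`), then `x = (−σ) • e_1`;
  so a loop crossing only the annulus of `ψ 3`, once, has shadow `±e_1`.

Everything is proved; no definitions, no named facts, no `sorry`. [folklore]
-/

noncomputable section

set_option linter.dupNamespace false

open Set Function
open Literature.Topology.FourManifolds Literature.Topology.FourManifolds.LefschetzBase
  Literature.GroupTheory.CombinatorialGroupTheory.SignedHurwitz

namespace Summit.SmoothPoincare4.SmoothPoincare4.Theorems.AcyclicBisectionExists.ModpBraidOrbits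

variable {g : ℕ}

/-- **A vector is determined by its pairings with the chain vectors.** [folklore] -/
theorem eq_of_stdSymp_chainVec_eq (x y : Fin g ⊕ Fin g → ℤ)
    (h : ∀ i : ℕ, i < 2 * g → stdSymp ℤ g (chainVec g i) x = stdSymp ℤ g (chainVec g i) y) : x = y := by
  obtain ⟨b, hb⟩ := chainVec_basis g
  have hL : (stdSymp ℤ g).flip x = (stdSymp ℤ g).flip y := by
    refine b.ext fun i => ?_
    rw [LinearMap.flip_apply, LinearMap.flip_apply, hb]
    exact h i i.2
  ext k
  rcases k with j | j
  · have h1 := congrArg (fun L => L (Pi.single (Sum.inr j) 1)) hL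
    simp only [LinearMap.flip_apply, stdSymp_int_single_inr] at h1
    linarith
  · have h1 := congrArg (fun L => L (Pi.single (Sum.inl j) 1)) hL
    simp only [LinearMap.flip_apply, stdSymp_int_single_inl] at h1
    exact h1

/-- **Pairings of `e_1` with the chain**: `stdSymp (chainVec g i) e_1 = −[i = 3]` (`i < 2g`, `g ≥ 2`).
[folklore] -/
theorem stdSymp_chainVec_single_inl_one (hg : 2 ≤ g) {i : ℕ} (hi : i < 2 * g) :
    stdSymp ℤ g (chainVec g i) (Pi.single (Sum.inl (⟨1, hg⟩ : Fin g)) 1) = if i = 3 then -1 else 0 := by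
  obtain ⟨j, rfl | rfl⟩ : ∃ j : ℕ, i = 2 * j ∨ i = 2 * j + 1 := ⟨i / 2, by omega⟩
  · have hj : j < g := by omega
    have h1 := chainVec_even g ⟨j, hj⟩
    dsimp only at h1
    rw [h1, if_neg (show ¬(2 * j = 3) by omega), map_sub, LinearMap.sub_apply, stdSymp_int_single_inl]
    by_cases h0 : 0 < j
    · rw [if_pos h0, stdSymp_int_single_inl]
      simp
    · rw [if_neg h0, map_zero, LinearMap.zero_apply]
      simp
  · have hj : j < g := by omega
    have h1 := chainVec_odd g ⟨j, hj⟩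
    dsimp only at h1
    rw [h1, stdSymp_int_single_inr]
    by_cases hj1 : j = 1
    · subst hj1
      rw [if_pos rfl]
      simp
    · rw [if_neg (by omega)]
      simp [Fin.ext_iff, hj1]

/-- **The class with pairings `σ [i = 3]` against the chain is `(−σ) e_1`** (`g ≥ 2`). [folklore] -/
theorem eq_single_one_of_stdSymp_chainVec (hg : 2 ≤ g) (x : Fin g ⊕ Fin g → ℤ) (σ : ℤ)
    (h : ∀ i : ℕ, i < 2 * g → stdSymp ℤ g (chainVec g i) x = if i = 3 then σ else 0) :
    x = (-σ) • Pi.single (Sum.inl (⟨1, hg⟩ : Fin g)) 1 := by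
  refine eq_of_stdSymp_chainVec_eq x _ fun i hi => ?_
  rw [h i hi, map_smul, smul_eq_mul, stdSymp_chainVec_single_inl_one hg hi]
  split_ifs <;> ring

/-! ## The registered form -/

/-- **Sub-goal `helper_eq_single_one_of_stdSymp_chainVec`** (G6-12, algebra for (R-E1CURVE) of node N3a): a
vector of `ℤ^{2g}` (`g ≥ 2`) pairing with the chain vectors `chainVec g i` (`i < 2g`) like `σ [i = 3]` is
`(−σ) • e_1`. [folklore] -/
theorem helper_eq_single_one_of_stdSymp_chainVec : ∀ (g : ℕ) (hg : 2 ≤ g) (x : Fin g ⊕ Fin g → ℤ) (σ : ℤ), (∀ i : ℕ, i < 2 * g → Literature.GroupTheory.CombinatorialGroupTheory.SignedHurwitz.stdSymp ℤ g (Literature.Topology.FourManifolds.LefschetzBase.chainVec g i) x = if i = 3 then σ else 0) → x = (-σ) • Pi.single (Sum.inl (⟨1, hg⟩ : Fin g)) 1 :=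
  fun _ hg x σ h => eq_single_one_of_stdSymp_chainVec hg x σ h

end Summit.SmoothPoincare4.SmoothPoincare4.Theorems.AcyclicBisectionExists.ModpBraidOrbits

end
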